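import Summits.CriticalPhenomena.CardyFormulaZ2.Theorems.CardyMagicRigidityNestingRigidityGapHierarchy
import HarnessLib

/-!
# Crux `NestingRigidity`, line `pinch-resampling` (v4), stub S12: the gap-entropy inequality of the single-linkage hierarchy

Crux `Summit.CriticalPhenomena.CardyFormulaZ2.Theses.CardyMagicRigidity.NestingRigidity`
(stmt-CriticalPhenomena-4835), line `pinch-resampling` v4, stub S12 `stub_neckHookupCoarseZ2 : NeckHookupCoarseZ2`.
Sequel of `…NestingRigidityGapHierarchy` (nodes `GapHierarchy.IsNode`, outer gaps `gapOut`, ratios `ratio` of a gap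
sequence `g 0, …, g (N - 1)` between `N + 1` points on a line): item (2) of the plan of the necklace summation
(`…NeckZ2NodeReimerSpatial`), as pure combinatorics.

**The gap-entropy inequality** (`GapHierarchy.prod_gaps_mul_span_le`, registered anchor `gapEntropy_le`): for positive
gaps, `(∏_{m < N} g m) · (span g 0 N + 1) ≤ 3 ^ N · ∏_{nodes Q ≠ root} max 1 (ratio Q)`, i.e.
`Σ_gaps log g + log (Δ_root + 1) ≤ Σ_{Q ≠ root} log⁺ ρ_Q + (log 3) N`: the entropy of the positions at unit
resolution is paid by the log-ratios of the proper nodes (leaves included, `ρ_leaf = G_leaf`), up to `log 3` per point.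
Proof (`preNode_bound`): Cartesian-tree induction over pre-nodes, splitting `[i, j]` at a maximal inner gap `g*`
(`GapHierarchy.argmaxGap`); both halves are pre-nodes with outer gap `g*`, the node factors below `[i, j]` dominate
those below the halves times the halves' own factors (`nodeFactors_split`, laminarity is not even needed), and
`g* (Δ_L + g* + Δ_R + 1) ≤ 3 · max (Δ_L + 1, g*) · max (Δ_R + 1, g*)` while `max (Δ + 1, g*) ≤ (Δ + 1) · max 1 ρ`
for a half which is a node (`ρ = g* / (Δ + 1)`) and `g* ≤ Δ` for a half which is not (it contains an inner gap `= g*`).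

Use (Kraft-type union bound over necklace skeletons): with a code of length `(1 + δ) log g + O(1)` per gap the code
length of a skeleton is `≤ (1 + δ) Σ_Q log⁺ ρ_Q + O_δ(N)`, against four-arm gains `(1 + ε) log ρ_Q - O(1)` per good node.

**Amended summation plan for `ZNodeAbsBoundChainA` (worker W6a, wave 6).**  It supersedes items (4)–(5) of the plan
in the module docstring of `…NeckZ2NodeReimerSpatial` and repairs three gaps of it.  Data of
`ω ∈ ZNodeEventChainA ℓ lam s x o` (a.s. a lattice configuration): ranks `e_1 < … < e_k`, locales `p_m = (e_m).2` on
the ring `{|y - x|_∞ = s + 1}`, points `u_0 = b`, `u_m = outP e_m`, whose open clusters `Y_m` INSIDE `Λ_{2s}(x)` are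
pairwise distinct; `Y_{m-1}, Y_m` meet the `ℓ`-ball of `p_m`; `Y_0 ∋ b`, `Y_k ∋ b'` reach the outer layer; `Y_{T_m}`
(`T_m ∈ {m-1, m}`, the cluster of `(e_m).2`) reaches sup distance `≥ lam/2` from `p_m`.
* GAP 1 (region): distinctness holds inside `Λ_{2s}(x)` only (the end clusters may be joined outside), so the glue is
  `real_fourArm_and_armsIn_le` (`…NeckZ2NodeReimerRegion`, `S = zBall x (2 s)`), not `real_fourArm_and_arms_le`.
* GAP 2 (arm entropy): an arm sub-annulus at resolution `ℓ` costs `O(log log (lam/ℓ))` nats, unbounded in the window;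
  arms use only the top `J ≍ 3 log₂ L` dyadic scales `lam / 2^{J+1} ≤ r ≤ lam / 2` (`lam / ℓ ≥ L³`), grouped in
  SLOTS of `K` scales, `K = K(C, α)` a constant with `C 2^{-α (K-1)} ≤ 1/(2e)`.
* GAP 3 (union bound): in `Σ_σ P(E_σ)` EVERY skeleton is summed, so arm data recorded in `σ` give no gain unless the
  skeleton set is restricted by a constraint checkable on `σ`: here a lower bound on the TOTAL number of claimed slots,
  which is a function of the cell configuration although the free slots of a single cell depend on the ranks.
Skeleton `σ = (n; a₀; g_1 … g_{n-1}; A; (Z_c)_{c ∈ A})`: `n` distinct ARC-CELLS of the locales (arc position on the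
square ring, `d_∞ ≤ d_arc^{cyc} ≤ 2 d_∞`, at resolution `ℓ`, the cycle cut inside a largest cyclic gap so that line
gaps under-estimate cyclic ones); first cell `a₀ ∈ [0, N_cells)`, gaps `g_i ≥ 1` (over-counting is free: no bijection
with subsets needed); `A` a set of cells with an INJECTIVE choice of big clusters `Y_{j_c}` touching `c` (`|A| ≥ n/2`
as `m ↦ T_m` is at most two-to-one); claimed slots `Z_c ⊆ [0, J/K)`.  Hierarchy `GapHierarchy.nodes (n-1) g` with
`g (n-1) := 4 s/ℓ` (root outer gap); node `Q = [i, j]`: centre the ring point of cell `i`, annulus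
`N_Q = zAnn w_Q (≍ 2 Δ_Q ℓ) (≍ G_Q ℓ / 8)` (`Δ = span`, `G = gapOut`; pairwise disjoint by `gapOut_le_span_of_lt`,
`gapOut_le_span_between`; free of locales; inside `Λ_{2s}`), GOOD iff `ratio ≥ M`.  Certificate of a good node: first
run `[i₁, j₁]` of consecutive ranks with cells in `Q`; `U_Q = Y_{i₁-1}`, `V_Q = Y_{j₁}` are distinct inside `Λ_{2s}`,
start within `ℓ` of `Q` and reach a cell outside `Q` or the outer layer ⇒ two crossings of `N_Q` not joined in it.
Arms: `c ∈ A`, slot `z`: `zOneArmAt c̃ (R₀ 2^{Kz}) (R₀ 2^{K(z+1)} - 1)`; CONFLICT `(c, Q)` iff `j_c ∈ {i₁(Q)-1, j₁(Q)}`,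
else cluster-exempt (a path in `Λ_{2s}` from `Y_{j_c}` to a crossing start joins `u_{j_c}` to `u_{i₁-1}` or `u_{j₁}`);
a conflicting good `Q` blocks, seen from `c̃`, a radial band of log-width `≤ log⁺ρ_Q + O(1)` (`c ∈ Q`) or `O(1)`
(`c ∉ Q`), i.e. `≤ log⁺ρ_Q /(K log 2) + O(1)` slots; `Z_c :=` ALL unblocked slots (spatially exempt from conflicting
nodes; slots of one cell have disjoint annuli, cells of `A` distinct clusters — the pairwise hypothesis of the glue).
As `c ↦ j_c` is injective and a node has two crossing clusters, `Σ_c #conflicts ≤ 2 #good ≤ 4n` (`card_nodes_le`), so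
`Σ_c |Z_c| ≥ |A| J/K - 2𝔊/(K log 2) - c₀ n`, `𝔊 := Σ_good log ρ_Q` — the ADMISSIBILITY constraint (with `|A| ≥ n/2`).
Accounting for admissible `σ` with `n` cells (`δ = ε/2`, `log M ≥ 4K₁/ε`, `α ≤ ε/16` WLOG): the code weight
`ν(σ) = N_cells⁻¹ ∏_i κ_δ g_i^{-(1+δ)} · 2^{-n} · 2^{-|A|J/K}` has `Σ_σ ν ≤ 1` (`Σ_{g≥1} g^{-(1+δ)} ≤ 1 + 1/δ = κ_δ⁻¹`);
this file gives `log (N_cells ∏ g_i^{1+δ}) ≤ (1+δ)(𝔊 + 2n log M + n log 3) + O(1)` (bad nodes: `log⁺ρ < log M`,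
`≤ 2n - 1` nodes; root: `log N_cells - log (Δ_root + 1) ≤ log⁺ρ_root + O(1)`); good nodes pay
`exp (-(1+ε)𝔊 + K₁ #good) ≤ exp (-(1+3ε/4) 𝔊)`; the arms pay `w₁^{Σ|Z_c|}`, `w₁ = C 2^{-α(K-1)}`, and against
`2^{-|A|J/K}` this is `≤ exp (-|A|J/K + 2α𝔊 + O(αK) n)`.  Total: `log (P(E_σ)/ν(σ)) ≤ -(ε/8)𝔊 + K_M n - nJ/(2K)
≤ -(n/K) log L` for `L ≥ L₀(ε, α, c, C, M, K)`, whence `P(ZNodeEventChainA) ≤ Σ_{n≥1} L^{-n/K} ≤ b`; no case analysis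
in `𝔊`, no Cauchy–Schwarz, and the window `s³ℓ ≤ lam⁴` is used only through `lam/ℓ ≥ L³`, `s/ℓ ≥ L⁴`.
-/

noncomputable section

namespace Summit.CriticalPhenomena.CardyFormulaZ2.Cruxes.NestingRigidity.PinchResampling

open Finset

namespace GapHierarchy

variable {N : ℕ} {g : ℕ → ℝ}

/-! ## §2 The gap-entropy inequality -/

/-- The node factors below an interval: `max 1 (ratio Q)` over the nodes `Q ⊆ [i, j]`, `Q ≠ [i, j]`. -/
def nodeFactors (N : ℕ) (g : ℕ → ℝ) (i j : ℕ) : ℝ :=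
  ∏ q ∈ (nodes N g).filter (fun q ↦ i ≤ q.1 ∧ q.2 ≤ j ∧ q ≠ (i, j)), max 1 (ratio N g q.1 q.2)

/-- Node factors are at least `1`. -/
theorem one_le_nodeFactors (i j : ℕ) : 1 ≤ nodeFactors N g i j := by
  unfold nodeFactors
  calc (1 : ℝ) = ∏ _q ∈ (nodes N g).filter (fun q ↦ i ≤ q.1 ∧ q.2 ≤ j ∧ q ≠ (i, j)), (1 : ℝ) := by simp
    _ ≤ _ := prod_le_prod (fun _ _ ↦ zero_le_one) fun _ _ ↦ le_max_left _ _

open scoped Classical in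
/-- **Splitting the node factors**: for `i ≤ m < j`, the node factors below `[i, j]` dominate the node factors below the
two halves `[i, m]`, `[m + 1, j]` times the own factors of the halves (when these are nodes). -/
theorem nodeFactors_split {i m j : ℕ} (him : i ≤ m) (hmj : m < j) :
    nodeFactors N g i m * nodeFactors N g (m + 1) j *
      ((if IsNode N g i m then max 1 (ratio N g i m) else 1) *
        (if IsNode N g (m + 1) j then max 1 (ratio N g (m + 1) j) else 1)) ≤ nodeFactors N g i j := by
  classical
  set f : ℕ × ℕ → ℝ := fun q ↦ max 1 (ratio N g q.1 q.2) with hf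
  have hf1 : ∀ q, 1 ≤ f q := fun q ↦ le_max_left _ _
  set S := (nodes N g).filter (fun q ↦ i ≤ q.1 ∧ q.2 ≤ j ∧ q ≠ (i, j)) with hS
  set SL := (nodes N g).filter (fun q ↦ i ≤ q.1 ∧ q.2 ≤ m ∧ q ≠ (i, m)) with hSL
  set SR := (nodes N g).filter (fun q ↦ m + 1 ≤ q.1 ∧ q.2 ≤ j ∧ q ≠ (m + 1, j)) with hSR
  set TL := (nodes N g).filter (fun q ↦ q = (i, m)) with hTL
  set TR := (nodes N g).filter (fun q ↦ q = (m + 1, j)) with hTR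
  -- the own factors of the halves
  have hTL' : ∏ q ∈ TL, f q = if IsNode N g i m then max 1 (ratio N g i m) else 1 := by
    by_cases h : IsNode N g i m
    · have : TL = {(i, m)} := by
        ext q
        simp only [hTL, mem_filter, mem_nodes, mem_singleton, and_iff_right_iff_imp]
        rintro rfl
        exact h
      rw [if_pos h, this, prod_singleton]
    · have : TL = ∅ := by
        ext q
        simp only [hTL, mem_filter, mem_nodes, notMem_empty, iff_false, not_and]
        rintro hq rfl
        exact h hq
      rw [if_neg h, this, prod_empty]
  have hTR' : ∏ q ∈ TR, f q = if IsNode N g (m + 1) j then max 1 (ratio N g (m + 1) j) else 1 := by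
    by_cases h : IsNode N g (m + 1) j
    · have : TR = {(m + 1, j)} := by
        ext q
        simp only [hTR, mem_filter, mem_nodes, mem_singleton, and_iff_right_iff_imp]
        rintro rfl
        exact h
      rw [if_pos h, this, prod_singleton]
    · have : TR = ∅ := by
        ext q
        simp only [hTR, mem_filter, mem_nodes, notMem_empty, iff_false, not_and]
        rintro hq rfl
        exact h hq
      rw [if_neg h, this, prod_empty]
  -- the four families are pairwise disjoint parts of `S`
  have hsub : SL ∪ SR ∪ (TL ∪ TR) ⊆ S := by
    intro q hq
    simp only [hSL, hSR, hTL, hTR, hS, mem_union, mem_filter, mem_nodes] at hq ⊢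
    rcases hq with (⟨hn, h1, h2, _⟩ | ⟨hn, h1, h2, _⟩) | (⟨hn, rfl⟩ | ⟨hn, rfl⟩)
    · exact ⟨hn, h1, by omega, fun h ↦ by rw [Prod.ext_iff] at h; simp only at h; omega⟩
    · exact ⟨hn, by omega, h2, fun h ↦ by rw [Prod.ext_iff] at h; simp only at h; omega⟩
    · exact ⟨hn, le_rfl, by simp only; omega, fun h ↦ by rw [Prod.ext_iff] at h; simp only at h; omega⟩
    · exact ⟨hn, by simp only; omega, le_rfl, fun h ↦ by rw [Prod.ext_iff] at h; simp only at h; omega⟩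
  have hd1 : Disjoint SL SR := by
    rw [disjoint_left]
    intro q hq hq'
    simp only [hSL, hSR, mem_filter, mem_nodes] at hq hq'
    have := hq.1.1
    omega
  have hd2 : Disjoint TL TR := by
    rw [disjoint_left]
    intro q hq hq'
    simp only [hTL, hTR, mem_filter] at hq hq'
    have h := hq.2.symm.trans hq'.2
    rw [Prod.ext_iff] at h
    simp only at h
    omega
  have hd3 : Disjoint (SL ∪ SR) (TL ∪ TR) := by
    rw [disjoint_left]
    intro q hq hq'
    simp only [hSL, hSR, hTL, hTR, mem_union, mem_filter, mem_nodes] at hq hq'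
    rcases hq' with ⟨-, rfl⟩ | ⟨-, rfl⟩
    · rcases hq with ⟨-, -, -, h⟩ | ⟨-, h, -, -⟩
      · exact h rfl
      · simp only at h; omega
    · rcases hq with ⟨-, -, h, -⟩ | ⟨-, -, -, h⟩
      · simp only at h; omega
      · exact h rfl
  calc nodeFactors N g i m * nodeFactors N g (m + 1) j *
        ((if IsNode N g i m then max 1 (ratio N g i m) else 1) *
          (if IsNode N g (m + 1) j then max 1 (ratio N g (m + 1) j) else 1))
      = (∏ q ∈ SL, f q) * (∏ q ∈ SR, f q) * ((∏ q ∈ TL, f q) * ∏ q ∈ TR, f q) := by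
        rw [hTL', hTR']; rfl
    _ = ∏ q ∈ SL ∪ SR ∪ (TL ∪ TR), f q := by
        rw [prod_union hd3, prod_union hd1, prod_union hd2]
    _ ≤ ∏ q ∈ S, f q := prod_le_prod_of_subset_of_one_le hsub (fun q _ ↦ zero_le_one.trans (hf1 q))
        fun q _ _ ↦ hf1 q

open scoped Classical in
/-- **The gap-entropy inequality along the Cartesian tree**: for every pre-node `[i, j]`,
`(∏_{i ≤ m < j} g m) · (span [i, j] + 1) ≤ 3 ^ (j - i) · (node factors below [i, j])`. -/
theorem preNode_bound (hg : ∀ m < N, 0 < g m) (d : ℕ) :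
    ∀ i j, j - i = d → IsPreNode N g i j →
      (∏ m ∈ Ico i j, g m) * (span g i j + 1) ≤ 3 ^ (j - i) * nodeFactors N g i j := by
  induction d using Nat.strong_induction_on with
  | _ d ih =>
  intro i j hd h
  obtain ⟨hij, hjN, hpre⟩ := h
  have hg' : ∀ m < N, 0 ≤ g m := fun m hm ↦ (hg m hm).le
  rcases hij.eq_or_lt with rfl | hlt
  · -- a leaf
    simp only [Ico_self, prod_empty, span, sum_empty, zero_add, mul_one, Nat.sub_self, pow_zero, one_mul]
    exact one_le_nodeFactors i i
  -- split at a maximal inner gap `ms`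
  obtain ⟨hms, hmax⟩ := argmaxGap_spec (g := g) hlt
  set ms := argmaxGap g i j with hmsdef
  rw [mem_Ico] at hms
  have hmsN : ms < N := by omega
  -- the two halves are pre-nodes
  have hL : IsPreNode N g i ms := ⟨hms.1, hmsN.le, fun m him hmm ↦
    ⟨fun hi ↦ (hpre m him (by omega)).1 hi, fun _ ↦ hmax m (mem_Ico.2 ⟨him, by omega⟩)⟩⟩
  have hR : IsPreNode N g (ms + 1) j := ⟨hms.2, hjN, fun m him hmm ↦
    ⟨fun _ ↦ by rw [Nat.add_sub_cancel]; exact hmax m (mem_Ico.2 ⟨by omega, hmm⟩),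
      fun hj ↦ (hpre m (by omega) hmm).2 hj⟩⟩
  have ihL := ih (ms - i) (by omega) i ms rfl hL
  have ihR := ih (j - (ms + 1)) (by omega) (ms + 1) j rfl hR
  -- both halves have outer gap `g ms`
  have hGL : gapOut N g i ms = g ms := by
    unfold gapOut
    by_cases hi0 : 0 < i
    · rw [if_pos hi0, if_pos hmsN]
      exact min_eq_right ((hpre ms hms.1 hms.2).1 hi0)
    · rw [if_neg hi0]
  have hGR : gapOut N g (ms + 1) j = g ms := by
    unfold gapOut
    rw [if_pos (Nat.succ_pos ms), Nat.add_sub_cancel]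
    by_cases hjN' : j < N
    · rw [if_pos hjN']
      exact min_eq_left ((hpre ms hms.1 hms.2).2 hjN')
    · rw [if_neg hjN']
  -- abbreviations
  set gs := g ms with hgs
  set DL := span g i ms with hDL
  set DR := span g (ms + 1) j with hDR
  set FL : ℝ := if IsNode N g i ms then max 1 (ratio N g i ms) else 1 with hFL
  set FR : ℝ := if IsNode N g (ms + 1) j then max 1 (ratio N g (ms + 1) j) else 1 with hFR
  have hgs0 : 0 ≤ gs := hg' ms hmsN
  have hDL0 : 0 ≤ DL := span_nonneg hg' hmsN.le
  have hDR0 : 0 ≤ DR := span_nonneg hg' hjN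
  have hFL1 : 1 ≤ FL := by
    rw [hFL]
    split_ifs
    · exact le_max_left _ _
    · exact le_rfl
  have hFR1 : 1 ≤ FR := by
    rw [hFR]
    split_ifs
    · exact le_max_left _ _
    · exact le_rfl
  -- the own factor of a half absorbs `g ms`: `max (Δ + 1, g ms) ≤ (Δ + 1) · F`
  have hAL : gs ≤ (DL + 1) * FL := by
    by_cases hn : IsNode N g i ms
    · rw [hFL, if_pos hn, ratio, hGL]
      calc gs = (DL + 1) * (gs / (DL + 1)) := by field_simp
        _ ≤ (DL + 1) * max 1 (gs / (DL + 1)) := by gcongr; exact le_max_right _ _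
    · rw [hFL, if_neg hn, mul_one]
      -- `[i, ms]` is not a node: some inner gap equals `g ms`
      have : ∃ m, i ≤ m ∧ m < ms ∧ gs ≤ g m := by
        by_contra hcon
        refine hn ⟨hms.1, hmsN.le, fun m him hmm ↦ ⟨fun hi ↦ ?_, fun _ ↦ ?_⟩⟩
        · have h1 : g m < gs := lt_of_not_ge fun hh ↦ hcon ⟨m, him, hmm, hh⟩
          exact h1.trans_le ((hpre ms hms.1 hms.2).1 hi)
        · exact lt_of_not_ge fun hh ↦ hcon ⟨m, him, hmm, hh⟩
      obtain ⟨m, him, hmm, hle⟩ := this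
      calc gs ≤ g m := hle
        _ ≤ DL := le_span_of_mem hg' hmsN.le him hmm
        _ ≤ DL + 1 := by linarith
  have hAR : gs ≤ (DR + 1) * FR := by
    by_cases hn : IsNode N g (ms + 1) j
    · rw [hFR, if_pos hn, ratio, hGR]
      calc gs = (DR + 1) * (gs / (DR + 1)) := by field_simp
        _ ≤ (DR + 1) * max 1 (gs / (DR + 1)) := by gcongr; exact le_max_right _ _
    · rw [hFR, if_neg hn, mul_one]
      have : ∃ m, ms + 1 ≤ m ∧ m < j ∧ gs ≤ g m := by
        by_contra hcon
        refine hn ⟨hms.2, hjN, fun m him hmm ↦ ⟨fun _ ↦ ?_, fun hj ↦ ?_⟩⟩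
        · rw [Nat.add_sub_cancel]
          exact lt_of_not_ge fun hh ↦ hcon ⟨m, him, hmm, hh⟩
        · have h1 : g m < gs := lt_of_not_ge fun hh ↦ hcon ⟨m, him, hmm, hh⟩
          exact h1.trans_le ((hpre ms hms.1 hms.2).2 hj)
      obtain ⟨m, him, hmm, hle⟩ := this
      calc gs ≤ g m := hle
        _ ≤ DR := le_span_of_mem hg' hjN him hmm
        _ ≤ DR + 1 := by linarith
  have hBL : DL + 1 ≤ (DL + 1) * FL := le_mul_of_one_le_right (by linarith) hFL1
  have hBR : DR + 1 ≤ (DR + 1) * FR := le_mul_of_one_le_right (by linarith) hFR1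
  -- the key three-term inequality
  have hAL0 : 0 ≤ (DL + 1) * FL := by positivity
  have hAR0 : 0 ≤ (DR + 1) * FR := by positivity
  have key : gs * (DL + gs + DR + 1) ≤ 3 * ((DL + 1) * FL) * ((DR + 1) * FR) := by
    calc gs * (DL + gs + DR + 1) ≤ gs * (DL + 1) + gs * gs + gs * (DR + 1) := by nlinarith
      _ ≤ (DR + 1) * FR * ((DL + 1) * FL) + (DL + 1) * FL * ((DR + 1) * FR) +
            (DL + 1) * FL * ((DR + 1) * FR) :=
          add_le_add_three (mul_le_mul hAR hBL (by linarith) hAR0) (mul_le_mul hAL hAR hgs0 hAL0)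
            (mul_le_mul hAL hBR (by linarith) hAL0)
      _ = 3 * ((DL + 1) * FL) * ((DR + 1) * FR) := by ring
  -- splitting the product, the span and the node factors
  have hprod : ∏ m ∈ Ico i j, g m = (∏ m ∈ Ico i ms, g m) * (gs * ∏ m ∈ Ico (ms + 1) j, g m) := by
    rw [← prod_Ico_consecutive g hms.1 hms.2.le, prod_eq_prod_Ico_succ_bot hms.2]
  have hspan : span g i j = DL + gs + DR := by
    rw [hDL, hDR, hgs, ← span_add_span hms.1 hms.2.le, span_eq_add hms.2, add_assoc]
  have hfac := nodeFactors_split (N := N) (g := g) hms.1 hms.2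
  have hpow : (3 : ℝ) ^ (j - i) = 3 ^ (ms - i) * 3 ^ (j - (ms + 1)) * 3 := by
    rw [← pow_add, ← pow_succ]
    congr 1
    omega
  have hPR0 : 0 ≤ ∏ m ∈ Ico (ms + 1) j, g m := prod_nonneg fun m hm ↦ hg' m (by rw [mem_Ico] at hm; omega)
  have hNL0 : 0 ≤ nodeFactors N g i ms := zero_le_one.trans (one_le_nodeFactors i ms)
  have hNR0 : 0 ≤ nodeFactors N g (ms + 1) j := zero_le_one.trans (one_le_nodeFactors (ms + 1) j)
  -- multiply through by `(DL + 1) (DR + 1) > 0`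
  have hpos : 0 < (DL + 1) * (DR + 1) := by positivity
  refine le_of_mul_le_mul_right ?_ hpos
  calc (∏ m ∈ Ico i j, g m) * (span g i j + 1) * ((DL + 1) * (DR + 1))
      = ((∏ m ∈ Ico i ms, g m) * (DL + 1)) * ((∏ m ∈ Ico (ms + 1) j, g m) * (DR + 1)) *
          (gs * (DL + gs + DR + 1)) := by rw [hprod, hspan]; ring
    _ ≤ (3 ^ (ms - i) * nodeFactors N g i ms) * (3 ^ (j - (ms + 1)) * nodeFactors N g (ms + 1) j) *
          (3 * ((DL + 1) * FL) * ((DR + 1) * FR)) :=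
        mul_le_mul (mul_le_mul ihL ihR (mul_nonneg hPR0 (by linarith)) (by positivity)) key (by positivity)
          (by positivity)
    _ = 3 ^ (ms - i) * 3 ^ (j - (ms + 1)) * 3 *
          (nodeFactors N g i ms * nodeFactors N g (ms + 1) j * (FL * FR)) * ((DL + 1) * (DR + 1)) := by ring
    _ ≤ 3 ^ (ms - i) * 3 ^ (j - (ms + 1)) * 3 * nodeFactors N g i j * ((DL + 1) * (DR + 1)) :=
        mul_le_mul_of_nonneg_right (mul_le_mul_of_nonneg_left hfac (by positivity)) hpos.le
    _ = 3 ^ (j - i) * nodeFactors N g i j * ((DL + 1) * (DR + 1)) := by rw [hpow]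

/-- The node factors below the root are the factors of all proper nodes. -/
theorem nodeFactors_root : nodeFactors N g 0 N = ∏ q ∈ (nodes N g).erase (0, N), max 1 (ratio N g q.1 q.2) := by
  unfold nodeFactors
  congr 1
  ext q
  simp only [mem_filter, mem_erase, mem_nodes, zero_le, true_and]
  constructor
  · rintro ⟨hn, -, hne⟩
    exact ⟨hne, hn⟩
  · rintro ⟨hne, hn⟩
    exact ⟨hn, hn.2.1, hne⟩

/-- **The gap-entropy inequality** (product form): for positive gaps,
`(∏_{m < N} g m) · (span [0, N] + 1) ≤ 3 ^ N · ∏_{nodes Q ≠ [0, N]} max 1 (ratio Q)`. -/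
theorem prod_gaps_mul_span_le (hg : ∀ m < N, 0 < g m) :
    (∏ m ∈ range N, g m) * (span g 0 N + 1) ≤
      3 ^ N * ∏ q ∈ (nodes N g).erase (0, N), max 1 (ratio N g q.1 q.2) := by
  have h := preNode_bound hg N 0 N (Nat.sub_zero N) isPreNode_root
  rw [Nat.sub_zero, nodeFactors_root] at h
  rwa [range_eq_Ico]

end GapHierarchy

/-- **Gap-entropy inequality for the single-linkage hierarchy of a gap sequence (registered helper, anchor of this
module on the crux item).**  For `N + 1` points on a line with consecutive gaps `g 0, …, g (N - 1) > 0`, the product of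
the gaps times (total span `+ 1`) is at most `3 ^ N` times the product, over the proper nodes `[i, j] ≠ [0, N]` of the
single-linkage hierarchy (`GapHierarchy.IsNode`: inner gaps smaller than the boundary gaps; leaves included), of
`max 1 (outer gap / (span + 1))` — the entropy of the positions is paid by the log-ratios of the nodes up to `log 3`
per point (`GapHierarchy.prod_gaps_mul_span_le`). -/
theorem gapEntropy_le : ∀ (N : ℕ) (g : ℕ → ℝ), (∀ m < N, 0 < g m) → (∏ m ∈ Finset.range N, g m) * (∑ m ∈ Finset.range N, g m + 1) ≤ 3 ^ N * ∏ q ∈ (GapHierarchy.nodes N g).erase (0, N), max 1 (GapHierarchy.gapOut N g q.1 q.2 / (∑ m ∈ Finset.Ico q.1 q.2, g m + 1)) :=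
  fun _ _ hg ↦ by
    simpa only [GapHierarchy.span, GapHierarchy.ratio, range_eq_Ico] using GapHierarchy.prod_gaps_mul_span_le hg

end Summit.CriticalPhenomena.CardyFormulaZ2.Cruxes.NestingRigidity.PinchResampling

end
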